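import Summits.ValiantsHypothesis.ValiantsHypothesis.Theorems.LacunarySymmetroidMatrixDescartesProfileLaw

/-!
# `MatrixDescartes` — line «range» §9 (val-idea-6 g4): the obligation `DetL1Bound` PROVED, and the violator-structure
# lemma with Erdős–Turán as an explicit hypothesis

HONEST FRAMING.  Helper file (`--supports stmt-ValiantsHypothesis-18050 --as helper`), porter val-port-4 g1 (val-lit merged
desk RULING #224 (1) / director-valiant g11 R102 (a): «§9 obligations file — `DetL1Bound` proved + Erdős–Turán-as-hypothesis
wiring»), companion of the ports of `Cruxes/MatrixDescartes/Lines/range.lean` (sha16 adf61982d4f67e59; val-idea-crit-2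
VERDICT #26 = PASS) and `Lines/profile.lean` (VERDICTs #24/#27 = PASS): (D) `…FiniteSectorHeightDefs` (p606753: `l1`, `Rrep`,
with `pencil` from `…FiniteSectorDefs`), (R) `…RangeLaw` (p607255), (P) `…ProfileLaw` (p607420: `ProfileLaw.abs_coeff_det_pencil_le`).
Crux: `Summit.ValiantsHypothesis.ValiantsHypothesis.Theses.LacunarySymmetroid.MatrixDescartes` (`stmt-ValiantsHypothesis-18050`),
asymptotic in `K` and height-FREE — NOTHING here bears on it, on Conjecture B at `m = 2`, or on `VP ≠ VNP`; no Theses import.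

CONTENT (§9 of the workfile, «assume the law fails»).
* `l1_det_pencil_le` / `detL1Bound` — the workfile's typed ROUTINE obligation `RangeLine.DetL1Bound` («letters bounded by `h` give
  `‖det P‖₁ ≤ m!·(K h)^m`»), now a THEOREM (statement = the `def`'s body verbatim, so no `def` is re-declared): `‖det P‖₁ =
  Σ_{r ≤ n} |a_r| ≤ Σ_{r ≤ n} m!·h^m·R_d^{(m)}(r)` by the permutation expansion (P) `ProfileLaw.abs_coeff_det_pencil_le`, and
  `Σ_{r ≤ n} R_d^{(m)}(r) ≤ K^m` because the fibres of `λ ↦ Σ_i d(λ i)` are disjoint in `Fin m → Fin K` (`sum_range_Rrep_le`).  No sign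
  hypothesis on `h` (the corner `h^m < 0` forces `K = 0`, where both sides vanish).
* `violator_degree` — the workfile's composition with its hypothesis `hL1 : DetL1Bound` DISCHARGED.  Its other hypothesis, the
  workfile's `ErdosTuranPositiveAxis`, is NOT declared here (a published theorem — Erdős–Turán, Ann. of Math. 51 (1950) 105–119,
  Thm 1, discrepancy constant `16`, with the angular sector shrunk onto the positive real axis, hence `Z₊² ≤ 16²·N·log(‖q‖₁/√|a₀a_N|)`;
  cf. Erdélyi, C. R. Acad. Sci. Paris 346 (2008) 267–270 — to be typed under `Literature/` by a literature-prover, director R102 (a));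
  it enters as an explicit `Prop` BINDER `hET` with that text verbatim, so both `violator_degree` and `violator_natDegree_ge` are
  CONDITIONAL on it and say so.  Reading: at letters of height `h` with `|c₀·lc| ≥ 1`, `Z₊² ≤ 256·deg(det P)·log(m!·(K h)^m)` — a
  pencil beating the crux's rate at quasi-polynomial height must waste degree quadratically in `Z₊` (doubly-exponentially in
  `K log K`): the opposite of the census's stamp / full formats (line «range» §7: the FULL sector of the height rung is a theorem,
  `Range.heightMDR_fullSector`).
[folklore] throughout (finite sums, fibre counting, monotonicity of `log`); the Erdős–Turán inequality is only ASSUMED.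
-/

-- `Summit.ValiantsHypothesis.ValiantsHypothesis.…` repeats a component by the D-0017 layout
-- (single-conjunct summit), which the `dupNamespace` linter flags; the name is mandated.
set_option linter.dupNamespace false

noncomputable section

namespace Summit.ValiantsHypothesis.ValiantsHypothesis.Theorems.LacunarySymmetroidMatrixDescartes.RangeObligations

open scoped BigOperators Matrix
open Polynomial
open Summit.ValiantsHypothesis.ValiantsHypothesis.Theorems.LacunarySymmetroidMatrixDescartes.FiniteSector

/-! ## §1 The coefficient `ℓ¹`-norm `…FiniteSector.l1` -/

/-- The constant coefficient is one of the summands of the `ℓ¹`-norm: `|a₀| ≤ ‖q‖₁` (workfile §9, verbatim). [folklore] -/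
theorem abs_coeff_zero_le_l1 (q : ℝ[X]) : |q.coeff 0| ≤ l1 q := by
  unfold l1
  exact Finset.single_le_sum (f := fun r => |q.coeff r|) (fun r _ => abs_nonneg _)
    (Finset.mem_range.2 (Nat.succ_pos _))

/-- The `ℓ¹`-norm is non-negative. [folklore] -/
theorem l1_nonneg (q : ℝ[X]) : 0 ≤ l1 q :=
  (abs_nonneg _).trans (abs_coeff_zero_le_l1 q)

/-! ## §2 Counting letter choices: `Σ_{r ≤ n} R_d^{(m)}(r) ≤ K^m` -/

/-- The representation numbers over any window sum to at most the number of letter choices `λ : Fin m → Fin K`: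
`Σ_{r ≤ n} R_d^{(m)}(r) ≤ K^m` (the fibres of `λ ↦ Σ_i d(λ i)` are disjoint). [folklore] -/
theorem sum_range_Rrep_le {K : ℕ} (d : Fin K → ℕ) (m n : ℕ) :
    ∑ r ∈ Finset.range (n + 1), Rrep d m r ≤ K ^ m := by
  have h1 := Finset.sum_card_fiberwise_eq_card_filter (Finset.univ : Finset (Fin m → Fin K))
    (Finset.range (n + 1)) (fun lam => ∑ i, d (lam i))
  unfold Rrep
  rw [h1]
  calc _ ≤ (Finset.univ : Finset (Fin m → Fin K)).card := Finset.card_filter_le _ _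
    _ = K ^ m := by simp

/-! ## §3 `DetL1Bound` PROVED: `‖det P‖₁ ≤ m! · (K h)^m` -/

/-- **`ℓ¹` height of a pencil determinant.**  Letters bounded by `h` give `‖det(Σ_l X^{d l} S_l)‖₁ ≤ m!·(K h)^m`:
`‖det P‖₁ = Σ_{r ≤ n} |a_r| ≤ Σ_{r ≤ n} m!·h^m·R_d^{(m)}(r)` (permutation expansion, `ProfileLaw.abs_coeff_det_pencil_le`)
`≤ m!·h^m·K^m` (`sum_range_Rrep_le`).  No sign hypothesis on `h`: if `h^m < 0` then `m > 0`, `h < 0`, so the letter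
bound forces `K = 0` and both sides vanish. [folklore] -/
theorem l1_det_pencil_le {m K : ℕ} (d : Fin K → ℕ) (S : Fin K → Matrix (Fin m) (Fin m) ℝ) {h : ℝ}
    (hS : ∀ l i j, |S l i j| ≤ h) :
    l1 (pencil d S).det ≤ (m.factorial : ℝ) * (K * h) ^ m := by
  set n := (pencil d S).det.natDegree with hn
  have hsum : l1 (pencil d S).det
      ≤ (m.factorial : ℝ) * h ^ m * ∑ r ∈ Finset.range (n + 1), (Rrep d m r : ℝ) := by
    unfold l1
    rw [Finset.mul_sum]
    refine Finset.sum_le_sum (fun r _ => ?_)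
    have := ProfileLaw.abs_coeff_det_pencil_le d S hS r
    linarith
  have hcount : (∑ r ∈ Finset.range (n + 1), (Rrep d m r : ℝ)) ≤ (K : ℝ) ^ m := by
    exact_mod_cast sum_range_Rrep_le d m n
  rcases le_or_gt 0 ((m.factorial : ℝ) * h ^ m) with hsign | hsign
  · calc l1 (pencil d S).det ≤ (m.factorial : ℝ) * h ^ m * ∑ r ∈ Finset.range (n + 1), (Rrep d m r : ℝ) := hsum
      _ ≤ (m.factorial : ℝ) * h ^ m * (K : ℝ) ^ m := mul_le_mul_of_nonneg_left hcount hsign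
      _ = (m.factorial : ℝ) * (K * h) ^ m := by ring
  · -- degenerate corner: `m! · h^m < 0` forces `m > 0` and `h < 0`, hence `K = 0` by the letter bound.
    have hfpos : (0 : ℝ) < m.factorial := by exact_mod_cast m.factorial_pos
    have hhm : h ^ m < 0 := by
      by_contra hcon
      exact absurd (mul_nonneg hfpos.le (not_lt.1 hcon)) (not_le.2 hsign)
    have hm : 0 < m := by
      rcases Nat.eq_zero_or_pos m with rfl | hm
      · norm_num at hhm
      · exact hm
    have hh : h < 0 := by
      by_contra hcon
      exact absurd (pow_nonneg (not_lt.1 hcon) m) (not_le.2 hhm)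
    have hK : K = 0 := by
      by_contra hK
      have hl : 0 < K := Nat.pos_of_ne_zero hK
      have := hS ⟨0, hl⟩ ⟨0, hm⟩ ⟨0, hm⟩
      linarith [abs_nonneg (S ⟨0, hl⟩ ⟨0, hm⟩ ⟨0, hm⟩)]
    subst hK
    have hR : ∀ r, (Rrep d m r : ℝ) = 0 := by
      intro r
      have hempty : (Finset.univ : Finset (Fin m → Fin 0)) = ∅ := by
        have : IsEmpty (Fin m → Fin 0) := by
          obtain ⟨i⟩ : Nonempty (Fin m) := ⟨⟨0, hm⟩⟩
          exact Function.isEmpty (fun f : Fin m → Fin 0 => f i)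
        exact Finset.univ_eq_empty
      simp [Rrep, hempty]
    calc l1 (pencil d S).det ≤ (m.factorial : ℝ) * h ^ m * ∑ r ∈ Finset.range (n + 1), (Rrep d m r : ℝ) := hsum
      _ = 0 := by simp [hR]
      _ = (m.factorial : ℝ) * ((0 : ℕ) * h) ^ m := by simp [zero_pow hm.ne']

/-- **Obligation `DetL1Bound` of line «range» (§9), PROVED** — statement = the workfile's `RangeLine.DetL1Bound` body
verbatim (with `l1`, `pencil` the `…FiniteSector` declarations): for every size `m`, number of letters `K`, design `d`, letters `S`
and bound `h`, `(∀ l i j, |S l i j| ≤ h) → ‖det P‖₁ ≤ m!·(K h)^m`. [folklore] -/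
theorem detL1Bound : ∀ (m K : ℕ) (d : Fin K → ℕ) (S : Fin K → Matrix (Fin m) (Fin m) ℝ) (h : ℝ),
    (∀ l i j, |S l i j| ≤ h) → l1 (pencil d S).det ≤ (m.factorial : ℝ) * (K * h) ^ m :=
  fun _ _ d S _ hS => l1_det_pencil_le d S hS

/-! ## §4 «Assume the law fails»: violator structure, with Erdős–Turán as an explicit hypothesis -/

/-- **Violator structure** (line «range» §9 `violator_degree`, with its routine hypothesis `DetL1Bound` now DISCHARGED by
`detL1Bound`).  The remaining hypothesis `hET` is the workfile's `ErdosTuranPositiveAxis` spelled out as an explicit `Prop`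
binder: «the number `Z₊` of distinct positive roots of a real polynomial `q` with `q(0) ≠ 0` satisfies
`Z₊² ≤ 256 · deg q · log(‖q‖₁ / √|a₀ · a_N|)» — the Erdős–Turán discrepancy theorem (Ann. of Math. 51 (1950), Thm 1, constant
`16`, so `16² = 256`) with the angular sector shrunk onto the positive real axis; a PUBLISHED theorem not yet typed under
`Literature/` (a literature-prover's named fact, deliberately not declared here), so this lemma is CONDITIONAL on it and says so.
Conclusion: a pencil with letters `≤ h` and `|c₀·lc| ≥ 1` has `Z₊² ≤ 256 · deg(det P) · log(m!·(K h)^m)` — at quasi-polynomial height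
a violator of the crux's rate is a DEGREE-INEFFICIENT, doubly-exponentially NON-FULL pencil, the opposite of the census's stamp / full
formats. [folklore] -/
theorem violator_degree
    (hET : ∀ q : ℝ[X], q.coeff 0 ≠ 0 →
      (((q.roots.filter (0 < ·)).toFinset.card : ℕ) : ℝ) ^ 2
        ≤ 256 * q.natDegree * Real.log (l1 q / Real.sqrt |q.coeff 0 * q.leadingCoeff|))
    {m K : ℕ} (d : Fin K → ℕ) (S : Fin K → Matrix (Fin m) (Fin m) ℝ) {h : ℝ} (hS : ∀ l i j, |S l i j| ≤ h)
    (hends : 1 ≤ |(pencil d S).det.coeff 0 * (pencil d S).det.leadingCoeff|) :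
    ((((pencil d S).det.roots.filter (0 < ·)).toFinset.card : ℕ) : ℝ) ^ 2
      ≤ 256 * (pencil d S).det.natDegree * Real.log ((m.factorial : ℝ) * (K * h) ^ m) := by
  set q := (pencil d S).det with hqdef
  have hc0 : q.coeff 0 ≠ 0 := by
    intro h0; rw [h0, zero_mul, abs_zero] at hends; exact absurd hends (by norm_num)
  have hsq : 1 ≤ Real.sqrt |q.coeff 0 * q.leadingCoeff| := by
    rw [show (1:ℝ) = Real.sqrt 1 by simp]; exact Real.sqrt_le_sqrt hends
  have hl1pos : 0 < l1 q := (abs_pos.2 hc0).trans_le (abs_coeff_zero_le_l1 q)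
  have hratio_pos : 0 < l1 q / Real.sqrt |q.coeff 0 * q.leadingCoeff| := div_pos hl1pos (by linarith)
  have hratio_le : l1 q / Real.sqrt |q.coeff 0 * q.leadingCoeff| ≤ (m.factorial : ℝ) * (K * h) ^ m :=
    (div_le_self hl1pos.le hsq).trans (l1_det_pencil_le d S hS)
  have hET' := hET q hc0
  calc _ ≤ 256 * (q.natDegree : ℝ) * Real.log (l1 q / Real.sqrt |q.coeff 0 * q.leadingCoeff|) := hET'
    _ ≤ 256 * (q.natDegree : ℝ) * Real.log ((m.factorial : ℝ) * (K * h) ^ m) :=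
        mul_le_mul_of_nonneg_left (Real.log_le_log hratio_pos hratio_le) (by positivity)

/-- **Degree floor of a violator** (division form of `violator_degree`): under the same Erdős–Turán hypothesis, whenever the
height budget `m!·(K h)^m` exceeds `1`, `deg(det P) ≥ Z₊² / (256 · log(m!·(K h)^m))` — a root count `Z₊` beyond the crux's rate
forces degree waste quadratic in `Z₊`, i.e. doubly-exponential in `K log K` at quasi-polynomial height.  CONDITIONAL on `hET`
exactly as `violator_degree`. [folklore] -/
theorem violator_natDegree_ge
    (hET : ∀ q : ℝ[X], q.coeff 0 ≠ 0 →
      (((q.roots.filter (0 < ·)).toFinset.card : ℕ) : ℝ) ^ 2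
        ≤ 256 * q.natDegree * Real.log (l1 q / Real.sqrt |q.coeff 0 * q.leadingCoeff|))
    {m K : ℕ} (d : Fin K → ℕ) (S : Fin K → Matrix (Fin m) (Fin m) ℝ) {h : ℝ} (hS : ∀ l i j, |S l i j| ≤ h)
    (hends : 1 ≤ |(pencil d S).det.coeff 0 * (pencil d S).det.leadingCoeff|)
    (hbudget : 1 < (m.factorial : ℝ) * (K * h) ^ m) :
    ((((pencil d S).det.roots.filter (0 < ·)).toFinset.card : ℕ) : ℝ) ^ 2
        / (256 * Real.log ((m.factorial : ℝ) * (K * h) ^ m))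
      ≤ (pencil d S).det.natDegree := by
  have hlog : 0 < Real.log ((m.factorial : ℝ) * (K * h) ^ m) := Real.log_pos hbudget
  have key := violator_degree hET d S hS hends
  rw [div_le_iff₀ (by positivity)]
  calc _ ≤ _ := key
    _ = (pencil d S).det.natDegree * (256 * Real.log ((m.factorial : ℝ) * (K * h) ^ m)) := by ring

end Summit.ValiantsHypothesis.ValiantsHypothesis.Theorems.LacunarySymmetroidMatrixDescartes.RangeObligations

end
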